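import Summits.RiemannHypothesis.RiemannHypothesis.Theorems.TiltedLandingLaw421R3FarStep

/-! # TiltedLandingLaw421R3FarStep3 — W-08 RATE^B support: the SIGN-FREE far energy drop in POSITION FORM (C3 g38 RESULT-3 (T4) / `energy_identity`)
PART 3 of the far-step kit, against the TREE module `…R3FarStep` (#1045) only (independent of part 2): the exact ENERGY IDENTITY in position form
`4b²(b² − Im w²) = ‖q(w)‖² − (‖w − a‖² − b²)(‖w − a‖² + 3b²)` (any position, no sign hypothesis) and its consequences under the one-point field bound
H-M `2‖w − a‖ ≤ M‖q(w)‖` (= `|K(w)| ≤ M` at a critical point): ★ `drop_ge_signfree` (δ ≥ (‖w−a‖²/b²)/M² − (‖w−a‖² − b²)(‖w−a‖² + 3b²)/(4b²)) and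
★ `drop_ge_outside` (UN-NESTED `b ≤ ‖w − a‖`: δ ≥ 1/M² − (‖w−a‖² − b²)(‖w−a‖² + 3b²)/(4b²) — the far purse NOT routed through `NestedStep`,
C6 ADD-126 knife-edge: the penalty is first order in the outwardness `‖w − a‖² − b²`), field forms via `q(w)·K = −2(w − a)`; §F.8 the TILT LAW (C3 (T2)): `tilt_core_ineq`, ★ `far_step_tilt` (nested + `b² ≤ (1+2ε)‖w − a‖²` + H-M ⇒
`(1+2ε)/((1+ε)²M²) ≤ b² − Im w²`, sharp, `ε = 0` = on-circle `1/M²`).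
SUPPORT for crux `TiltedLandingLaw421` (stmt-RiemannHypothesis-24774), helper only; sorry-free. Nothing here bears on the truth of RH; RH is NOT proved; 24774 OPEN. -/

namespace RhW08.FarStep

open Complex Metric Set
open scoped ComplexConjugate
open RhW08.IsolatedTilt

/-! ## §F.7 the SIGN-FREE energy identity and drop bounds (position form) -/

/-- ★ (K) §F.7 **THE ENERGY IDENTITY, POSITION FORM** (C3 g38 `energy_identity` × `‖q(w)‖²/|κ|²`): for every `w`,
`4b²·(b² − Im w²) = ‖q(w)‖² − (‖w − a‖² − b²)·(‖w − a‖² + 3b²)`. No sign, far or field hypothesis. -/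
theorem drop_identity_position (a b : ℝ) (w : ℂ) :
    4 * b ^ 2 * (b ^ 2 - w.im ^ 2) = ‖pairQ a b w‖ ^ 2 - (‖w - a‖ ^ 2 - b ^ 2) * (‖w - a‖ ^ 2 + 3 * b ^ 2) := by
  have hs : ‖w - (a : ℂ)‖ ^ 2 = (w.re - a) ^ 2 + w.im ^ 2 := by
    rw [← Complex.normSq_eq_norm_sq, Complex.normSq_apply, Complex.sub_re, Complex.sub_im, Complex.ofReal_re,
      Complex.ofReal_im, sub_zero]
    ring
  have hP : ‖pairQ a b w‖ ^ 2 = ((w.re - a) ^ 2 - w.im ^ 2 + b ^ 2) ^ 2 + (2 * (w.re - a) * w.im) ^ 2 := by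
    rw [← Complex.normSq_eq_norm_sq, Complex.normSq_apply, pairQ_re, pairQ_im]; ring
  rw [hs, hP]; ring

/-- ★★ (K) §F.7 **SIGN-FREE DROP BOUND** under the one-point field bound H-M `2‖w − a‖ ≤ M‖q(w)‖`:
`(‖w − a‖²/b²)/M² − (‖w − a‖² − b²)(‖w − a‖² + 3b²)/(4b²) ≤ b² − Im w²` (nested: the second term is a bonus; un-nested: a first-order penalty). -/
theorem drop_ge_signfree {w : ℂ} {a b M : ℝ} (hb : 0 < b) (hM0 : 0 < M) (hM : 2 * ‖w - a‖ ≤ M * ‖pairQ a b w‖) :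
    ‖w - a‖ ^ 2 / b ^ 2 / M ^ 2 - (‖w - a‖ ^ 2 - b ^ 2) * (‖w - a‖ ^ 2 + 3 * b ^ 2) / (4 * b ^ 2) ≤ b ^ 2 - w.im ^ 2 := by
  have hid := drop_identity_position a b w
  have hM2 : 4 * ‖w - (a : ℂ)‖ ^ 2 ≤ M ^ 2 * ‖pairQ a b w‖ ^ 2 := by
    have h0 : 0 ≤ 2 * ‖w - (a : ℂ)‖ := by positivity
    have := mul_self_le_mul_self h0 hM
    nlinarith [this]
  have hb2 : 0 < b ^ 2 := pow_pos hb 2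
  have hM2pos : 0 < M ^ 2 := pow_pos hM0 2
  have h1 : ‖w - (a : ℂ)‖ ^ 2 / b ^ 2 / M ^ 2 = 4 * ‖w - (a : ℂ)‖ ^ 2 / (4 * b ^ 2 * M ^ 2) := by
    field_simp
  have h2 : 4 * ‖w - (a : ℂ)‖ ^ 2 / (4 * b ^ 2 * M ^ 2) ≤ M ^ 2 * ‖pairQ a b w‖ ^ 2 / (4 * b ^ 2 * M ^ 2) :=
    div_le_div_of_nonneg_right hM2 (by positivity)
  have h3 : M ^ 2 * ‖pairQ a b w‖ ^ 2 / (4 * b ^ 2 * M ^ 2) = ‖pairQ a b w‖ ^ 2 / (4 * b ^ 2) := by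
    field_simp
  have h4 : ‖pairQ a b w‖ ^ 2 / (4 * b ^ 2) - (‖w - a‖ ^ 2 - b ^ 2) * (‖w - a‖ ^ 2 + 3 * b ^ 2) / (4 * b ^ 2) = b ^ 2 - w.im ^ 2 := by
    rw [← sub_div, ← hid]; field_simp
  linarith [h1, h2, h3, h4]

/-- ★★ (K) §F.7 **THE UN-NESTED (outward) CASE** (C3 (T4), C6 ADD-126 knife-edge): `b ≤ ‖w − a‖` and H-M ⇒
`1/M² − (‖w − a‖² − b²)(‖w − a‖² + 3b²)/(4b²) ≤ b² − Im w²` — the far energy purse without `NestedStep`. -/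
theorem drop_ge_outside {w : ℂ} {a b M : ℝ} (hb : 0 < b) (hM0 : 0 < M) (hM : 2 * ‖w - a‖ ≤ M * ‖pairQ a b w‖)
    (hout : b ≤ ‖w - a‖) :
    1 / M ^ 2 - (‖w - a‖ ^ 2 - b ^ 2) * (‖w - a‖ ^ 2 + 3 * b ^ 2) / (4 * b ^ 2) ≤ b ^ 2 - w.im ^ 2 := by
  have h := drop_ge_signfree hb hM0 hM
  have hb2 : 0 < b ^ 2 := pow_pos hb 2
  have hsq : b ^ 2 ≤ ‖w - (a : ℂ)‖ ^ 2 := by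
    have := mul_self_le_mul_self hb.le hout
    nlinarith [this]
  have h1 : 1 ≤ ‖w - (a : ℂ)‖ ^ 2 / b ^ 2 := by rw [le_div_iff₀ hb2, one_mul]; exact hsq
  have h2 : 1 / M ^ 2 ≤ ‖w - (a : ℂ)‖ ^ 2 / b ^ 2 / M ^ 2 := div_le_div_of_nonneg_right h1 (by positivity)
  linarith

/-- (K) §F.7 H-M from the field: `q(w)·K = −2(w − a)` and `‖K‖ ≤ M` give `2‖w − a‖ ≤ M‖q(w)‖` (no far hypothesis needed). -/
theorem hM_of_field {w K : ℂ} {a b M : ℝ} (h : pairQ a b w * K = -(2 * (w - a))) (hKM : ‖K‖ ≤ M) :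
    2 * ‖w - a‖ ≤ M * ‖pairQ a b w‖ := by
  have hn : ‖pairQ a b w‖ * ‖K‖ = 2 * ‖w - a‖ := by
    rw [← norm_mul, h, norm_neg, norm_mul, Complex.norm_ofNat]
  rw [← hn, mul_comm]
  exact mul_le_mul_of_nonneg_right hKM (norm_nonneg _)

/-- ★★★ (K) §F.7 **SIGN-FREE FAR STEP, FIELD FORM**: `G = q·h` on `ball a ρ`, a critical point `w` of `G` in the ball with `h w ≠ 0` and
`‖h′(w)/h(w)‖ ≤ M` ⇒ `(‖w − a‖²/b²)/M² − (‖w − a‖² − b²)(‖w − a‖² + 3b²)/(4b²) ≤ b² − Im w²` (nested or not). -/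
theorem far_step_signfree_of_field {G h : ℂ → ℂ} {a b ρ M : ℝ} (hh : DifferentiableOn ℂ h (ball (a : ℂ) ρ))
    (hG : ∀ z ∈ ball (a : ℂ) ρ, G z = pairQ a b z * h z) {w : ℂ} (hw : w ∈ ball (a : ℂ) ρ) (hhw : h w ≠ 0)
    (hcrit : deriv G w = 0) (hb : 0 < b) (hM0 : 0 < M) (hKM : ‖deriv h w / h w‖ ≤ M) :
    ‖w - a‖ ^ 2 / b ^ 2 / M ^ 2 - (‖w - a‖ ^ 2 - b ^ 2) * (‖w - a‖ ^ 2 + 3 * b ^ 2) / (4 * b ^ 2) ≤ b ^ 2 - w.im ^ 2 :=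
  drop_ge_signfree hb hM0 (hM_of_field (crit_field_identity hh hG hw hhw hcrit) hKM)

/-! ## §F.8 the TILT law (C3 g38 (T2)): H-SIGN + H-TILT(ε) + H-M ⟹ drop ≥ c(ε)/M², c(ε) = (1+2ε)/(1+ε)² (sharp; ε = 0 is the on-circle law c = 1) -/

/-- (K) §F.8 the core polynomial inequality of (T2): for `0 ≤ t ≤ s ≤ B ≤ (1+2ε)s`, `0 < s`, `0 ≤ ε`:
`(1+2ε)·((s+B)² − 4Bt) ≤ 4s(B − t)(1+ε)²` (linear in `t`; endpoint certificates `((1+2ε)s − B)((1+2ε)B − s)` and `(B − s)(4s(1+ε)² − (1+2ε)(B − s))`). -/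
theorem tilt_core_ineq {s t B ε : ℝ} (hs : 0 < s) (hε : 0 ≤ ε) (ht0 : 0 ≤ t) (hts : t ≤ s) (hsB : s ≤ B)
    (htilt : B ≤ (1 + 2 * ε) * s) : (1 + 2 * ε) * ((s + B) ^ 2 - 4 * B * t) ≤ 4 * s * (B - t) * (1 + ε) ^ 2 := by
  have hG0 : 0 ≤ 4 * s * B * (1 + ε) ^ 2 - (1 + 2 * ε) * (s + B) ^ 2 := by
    have h1 : 0 ≤ ((1 + 2 * ε) * s - B) * ((1 + 2 * ε) * B - s) := mul_nonneg (by linarith) (by nlinarith)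
    nlinarith [h1]
  have hGs : 0 ≤ 4 * s * (B - s) * (1 + ε) ^ 2 - (1 + 2 * ε) * (B - s) ^ 2 := by
    have h2 : 0 ≤ 4 * s * (1 + ε) ^ 2 - (1 + 2 * ε) * (B - s) := by nlinarith
    have h3 : 0 ≤ (B - s) * (4 * s * (1 + ε) ^ 2 - (1 + 2 * ε) * (B - s)) := mul_nonneg (by linarith) h2
    nlinarith [h3]
  have key : s * (4 * s * (B - t) * (1 + ε) ^ 2 - (1 + 2 * ε) * ((s + B) ^ 2 - 4 * B * t))
      = (s - t) * (4 * s * B * (1 + ε) ^ 2 - (1 + 2 * ε) * (s + B) ^ 2)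
        + t * (4 * s * (B - s) * (1 + ε) ^ 2 - (1 + 2 * ε) * (B - s) ^ 2) := by ring
  have h4 : 0 ≤ s * (4 * s * (B - t) * (1 + ε) ^ 2 - (1 + 2 * ε) * ((s + B) ^ 2 - 4 * B * t)) := by
    rw [key]; exact add_nonneg (mul_nonneg (by linarith) hG0) (mul_nonneg ht0 hGs)
  nlinarith [h4, hs]

/-- ★★ (K) §F.8 **THE TILT LAW, POSITION FORM** (C3 g38 (T2)): NESTED `‖w − a‖ ≤ b`, TILT `b² ≤ (1+2ε)‖w − a‖²` (= H-TILT ε: `−Im κ ≤ ε·Im w·|κ|²`)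
and H-M `2‖w − a‖ ≤ M‖q(w)‖` ⇒ `(1+2ε)/((1+ε)²·M²) ≤ b² − Im w²`; `ε = 0` (on the circle) gives the sharp `1/M²`. No far clause and no `0 < b` needed. -/
theorem far_step_tilt {w : ℂ} {a b M ε : ℝ} (hw : 0 < w.im) (hM0 : 0 < M) (hε : 0 ≤ ε)
    (hsign : ‖w - a‖ ≤ b) (htilt : b ^ 2 ≤ (1 + 2 * ε) * ‖w - a‖ ^ 2) (hM : 2 * ‖w - a‖ ≤ M * ‖pairQ a b w‖) :
    (1 + 2 * ε) / ((1 + ε) ^ 2 * M ^ 2) ≤ b ^ 2 - w.im ^ 2 := by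
  set s : ℝ := ‖w - (a : ℂ)‖ ^ 2 with hs_def
  have hs_eq : s = (w.re - a) ^ 2 + w.im ^ 2 := by
    rw [hs_def, ← Complex.normSq_eq_norm_sq, Complex.normSq_apply, Complex.sub_re, Complex.sub_im, Complex.ofReal_re,
      Complex.ofReal_im, sub_zero]
    ring
  have hP : ‖pairQ a b w‖ ^ 2 = (s + b ^ 2) ^ 2 - 4 * b ^ 2 * w.im ^ 2 := by
    have := drop_identity_position a b w
    rw [hs_def]
    linear_combination (-1 : ℝ) * this
  have hts : w.im ^ 2 ≤ s := by rw [hs_eq]; nlinarith [sq_nonneg (w.re - a)]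
  have ht0 : 0 ≤ w.im ^ 2 := sq_nonneg _
  have hsB : s ≤ b ^ 2 := by
    rw [hs_def]
    have := mul_self_le_mul_self (norm_nonneg _) hsign
    nlinarith [this]
  have hspos : 0 < s := by rw [hs_eq]; nlinarith [sq_nonneg (w.re - a), mul_pos hw hw]
  have hM2 : 4 * s ≤ M ^ 2 * ((s + b ^ 2) ^ 2 - 4 * b ^ 2 * w.im ^ 2) := by
    rw [← hP, hs_def]
    have h0 : 0 ≤ 2 * ‖w - (a : ℂ)‖ := by positivity
    have := mul_self_le_mul_self h0 hM
    nlinarith [this]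
  have hcore := tilt_core_ineq hspos hε ht0 hts hsB htilt
  have h1 : (1 + 2 * ε) * (4 * s) ≤ M ^ 2 * (4 * s * (b ^ 2 - w.im ^ 2) * (1 + ε) ^ 2) := by
    have := mul_le_mul_of_nonneg_left hM2 (show (0 : ℝ) ≤ 1 + 2 * ε by linarith)
    have h' := mul_le_mul_of_nonneg_left hcore (sq_nonneg M)
    nlinarith [this, h']
  have h2 : 1 + 2 * ε ≤ (1 + ε) ^ 2 * M ^ 2 * (b ^ 2 - w.im ^ 2) := by
    by_contra h3
    push Not at h3
    nlinarith [h1, hspos, h3]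
  rw [div_le_iff₀ (by positivity)]
  linarith

end RhW08.FarStep
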